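import Summits.AnomalousDissipation.AnomalousDissipation.Theses.TwoAndHalfD
import Literature.Analysis.FluidPDE.LerayHopfMomentum
import Literature.Analysis.FluidPDE.AlexakisDoeringProofs
import Literature.Analysis.FluidPDE.LongTimeAverageNonneg

/-!
# O3 `stub_strainSqLeEnstrophy` — Jensen for the honest `limsup` means
# (line `Sketch`, crux stmt-AnomalousDissipation-0206)

Registered tool stub (section O, the witness window) of the line `Sketch` (duhamel-release) for the crux
`Summit.AnomalousDissipation.AnomalousDissipation.Theses.TwoAndHalfD.TwohalfdThesis`
(stmt-AnomalousDissipation-0206).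

CONTENT.  Along ONE global Leray–Hopf solution `v` of the planar Navier–Stokes system with a steady force
`g ∈ L²`, `∫ g = 0` and `ν > 0`, the `limsup` long-time means `⟨·⟩ = longTimeAvgSup` of the strain
`√Z` and of the enstrophy `Z = ‖∇v‖₂²` (`Z t = (eGradNormSq (v t)).toReal ≥ 0`) satisfy
`⟨√Z⟩² ≤ ⟨Z⟩`.

* `longTimeAvgSup_sqrt_eGradNormSq_le_sqrt` — the un-squared form `⟨√Z⟩ ≤ √⟨Z⟩` on `T^d`, any `d`.
* `stub_strainSqLeEnstrophy` — the registered statement (square both sides; `⟨√Z⟩, ⟨Z⟩ ≥ 0`).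

PROOF.  The running means of `Z` are bounded (`IsGlobalLerayHopf.isBoundedUnder_timeMean_dissipation`
divided by `ν`; this is `isBoundedUnder_timeMean_eGradNormSq` of `…TwohalfdThesisStrainGateEnstrophy.lean`,
whose 8 lines are copied privately here rather than importing that heavy module), so the real `limsup`
`L = ⟨Z⟩` is honest: for every `δ > 0` eventually `⟨Z⟩_T < L + δ` (`Filter.eventually_lt_of_limsup_lt`).
Jensen on one window, `⟨√Z⟩_T ≤ √⟨Z⟩_T` (`timeMean_sqrt_le_sqrt_timeMean`; `Z` is integrable on `(0,T)`
by `integrable_toReal_of_lintegral_ne_top` and `IsLerayHopfOn.lintegral_eGradNormSq_lt_top`), gives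
eventually `⟨√Z⟩_T ≤ √(L + δ)`, and `limsup_le_of_forall_pos_eventually_le` (`√(L + δ) → √L` as `δ → 0⁺`)
yields `⟨√Z⟩ ≤ √L`.  Model: `longTimeAvgSup_sqrt_le_sqrt_add_one` in `…TwohalfdThesisStubShellNoGo.lean`
(the `√(R+1)` version), sharpened.  Supports stmt-AnomalousDissipation-0206.

## Mathlib / Literature search

`lean search 'longTimeAvgSup_sqrt'` (only the `√(R+1)` template `longTimeAvgSup_sqrt_le_sqrt_add_one` and
section comparisons), `'sqrt_le_sqrt_timeMean'` (`Literature/Analysis/FluidPDE/AlexakisDoeringProofs.lean`: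
`timeMean_sqrt_le_sqrt_timeMean`, `limsup_le_of_forall_pos_eventually_le`),
`'isBoundedUnder_timeMean_dissipation'` (`Literature/Analysis/FluidPDE/LerayHopfMomentum.lean`),
`'longTimeAvgSup_le_of_eventually_le'` (`LongTimeAverageSlidingWindow.lean`, not needed here),
`'theorem longTimeAvgSup_nonneg'` (`LongTimeAverageNonneg.lean`), `'isBoundedUnder_timeMean_eGradNormSq'`
(StrainGateEnstrophy, planar only);
Mathlib: `Filter.eventually_lt_of_limsup_lt`, `Filter.Tendsto.sqrt`, `Real.sqrt_le_sqrt`, `Real.sq_sqrt`,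
`pow_le_pow_left₀`.  `lean find` (prior stockroom: `longTimeAvgSup`, `sqrt_le_sqrt_timeMean`): nothing to adapt.
-/

noncomputable section

-- the summit path AnomalousDissipation/AnomalousDissipation duplicates a namespace component
set_option linter.dupNamespace false

namespace Summit.AnomalousDissipation.AnomalousDissipation.Theorems.TwohalfdThesis

open MeasureTheory Set Filter Topology
open scoped ENNReal NNReal
open Literature.Analysis.FunctionSpaces Literature.Analysis.FluidPDE

/-- **Bounded running means of the enstrophy** along a global Leray–Hopf solution on `T^d` with steady
mean-zero force `g ∈ L²` and `ν > 0`: `IsGlobalLerayHopf.isBoundedUnder_timeMean_dissipation` divided by `ν`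
(private copy, in any dimension, of `isBoundedUnder_timeMean_eGradNormSq` of
`…TwohalfdThesisStrainGateEnstrophy.lean`). [folklore] -/
private theorem isBoundedUnder_timeMean_toReal_eGradNormSq {d : Type*} [Fintype d] [DecidableEq d]
    {ν : ℝ} {g v₀ : UnitAddTorus d → EuclideanSpace ℝ d} {v : ℝ → UnitAddTorus d → EuclideanSpace ℝ d}
    (hν : 0 < ν) (hg : MemLp g 2 volume) (hgz : Torus.HasZeroMean g)
    (hLH : Torus.IsGlobalLerayHopf ν (fun _ => g) v₀ v) :
    IsBoundedUnder (· ≤ ·) atTop (timeMean fun t => (Torus.eGradNormSq (v t)).toReal) := by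
  -- adapted from `isBoundedUnder_timeMean_eGradNormSq` (TwoAndHalfDTwohalfdThesisStrainGateEnstrophy)
  obtain ⟨b, hb⟩ := hLH.isBoundedUnder_timeMean_dissipation hν hg hgz
  refine ⟨b / ν, ?_⟩
  rw [eventually_map] at hb ⊢
  filter_upwards [hb] with T hT
  rw [timeMean_const_mul] at hT
  rw [le_div_iff₀ hν]
  linarith [mul_comm ν (timeMean (fun t => (Torus.eGradNormSq (v t)).toReal) T)]

/-- **Jensen for the honest `limsup` means, un-squared form.**  Along a global Leray–Hopf solution `v` on
`T^d` with steady mean-zero force `g ∈ L²` and `ν > 0`: `⟨‖∇v‖₂⟩ ≤ √⟨‖∇v‖₂²⟩`, where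
`⟨·⟩ = longTimeAvgSup` (the running means of the enstrophy are bounded, so its real `limsup` `L` is
honest; windowed Jensen `⟨√Z⟩_T ≤ √⟨Z⟩_T ≤ √(L + δ)` eventually, for every `δ > 0`). [folklore] -/
theorem longTimeAvgSup_sqrt_eGradNormSq_le_sqrt {d : Type*} [Fintype d] [DecidableEq d]
    {ν : ℝ} {g v₀ : UnitAddTorus d → EuclideanSpace ℝ d} {v : ℝ → UnitAddTorus d → EuclideanSpace ℝ d}
    (hν : 0 < ν) (hg : MemLp g 2 volume) (hgz : Torus.HasZeroMean g)
    (hLH : Torus.IsGlobalLerayHopf ν (fun _ => g) v₀ v) :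
    longTimeAvgSup (fun t => Real.sqrt (Torus.eGradNormSq (v t)).toReal) ≤
      Real.sqrt (longTimeAvgSup (fun t => (Torus.eGradNormSq (v t)).toReal)) := by
  set Z : ℝ → ℝ := fun t => (Torus.eGradNormSq (v t)).toReal with hZdef
  set ψ : ℝ → ℝ := fun t => Real.sqrt (Torus.eGradNormSq (v t)).toReal with hψdef
  have hZ0 : ∀ t, 0 ≤ Z t := fun t => ENNReal.toReal_nonneg
  have hψ0 : ∀ t, 0 ≤ ψ t := fun t => Real.sqrt_nonneg _
  -- bounded running means of `Z` (Doering–Foias / FMRT (3.4)): the real `limsup` below is honest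
  have hbZ : IsBoundedUnder (· ≤ ·) atTop (timeMean Z) :=
    isBoundedUnder_timeMean_toReal_eGradNormSq hν hg hgz hLH
  set L : ℝ := longTimeAvgSup Z with hLdef
  have hL : limsup (timeMean Z) atTop = L := rfl
  -- the running means of `ψ` are eventually nonnegative
  have hψm0 : ∀ᶠ T in atTop, 0 ≤ timeMean ψ T := by
    filter_upwards [eventually_ge_atTop (0 : ℝ)] with T hT using timeMean_nonneg hψ0 hT
  show limsup (timeMean ψ) atTop ≤ Real.sqrt L
  refine limsup_le_of_forall_pos_eventually_le (h := fun δ => Real.sqrt (L + δ)) hψm0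
    (fun δ hδ => ?_) ?_
  · -- eventually `⟨Z⟩_T < L + δ`, and Jensen on the window `(0, T)`
    have hev : ∀ᶠ T in atTop, timeMean Z T < L + δ :=
      eventually_lt_of_limsup_lt (by rw [hL]; linarith) hbZ
    filter_upwards [hev, eventually_gt_atTop (0 : ℝ)] with T hT hT0
    have hZi : IntegrableOn Z (Ioc 0 T) := by
      rw [integrableOn_Ioc_iff_integrableOn_Ioo]
      exact integrable_toReal_of_lintegral_ne_top (hLH T hT0).aemeasurable_eGradNormSq
        (hLH T hT0).lintegral_eGradNormSq_lt_top.ne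
    calc timeMean ψ T ≤ Real.sqrt (timeMean Z T) := timeMean_sqrt_le_sqrt_timeMean hT0 hZ0 hZi
      _ ≤ Real.sqrt (L + δ) := Real.sqrt_le_sqrt hT.le
  · -- `√(L + δ) → √L` as `δ → 0⁺`
    have hc : Tendsto (fun δ : ℝ => L + δ) (𝓝 0) (𝓝 L) := by
      simpa using (tendsto_const_nhds (x := L)).add (tendsto_id (x := 𝓝 (0 : ℝ)))
    exact (hc.mono_left nhdsWithin_le_nhds).sqrt

/-- **O3 `stub_strainSqLeEnstrophy` (line `Sketch` = duhamel-release, crux `TwoAndHalfD.TwohalfdThesis`;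
registered signature): Jensen for the honest `limsup` means.**  Along ONE global Leray–Hopf solution `v` of
the planar Navier–Stokes system with steady force `g ∈ L²`, `∫ g = 0`, `ν > 0`:
`⟨‖∇v‖₂⟩² ≤ ⟨‖∇v‖₂²⟩` (`⟨·⟩ = longTimeAvgSup = limsup` of running means; square
`longTimeAvgSup_sqrt_eGradNormSq_le_sqrt`, both means being nonnegative). [folklore] -/
theorem stub_strainSqLeEnstrophy :
    ∀ (ν : ℝ) (g : UnitAddTorus (Fin 2) → EuclideanSpace ℝ (Fin 2))
      (v₀ : UnitAddTorus (Fin 2) → EuclideanSpace ℝ (Fin 2))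
      (v : ℝ → UnitAddTorus (Fin 2) → EuclideanSpace ℝ (Fin 2)),
      0 < ν → MemLp g 2 volume → Torus.HasZeroMean g →
      Torus.IsGlobalLerayHopf ν (fun _ => g) v₀ v →
      (longTimeAvgSup (fun t => Real.sqrt (Torus.eGradNormSq (v t)).toReal)) ^ 2 ≤
        longTimeAvgSup (fun t => (Torus.eGradNormSq (v t)).toReal) := by
  intro ν g v₀ v hν hg hgz hLH
  have hS0 : 0 ≤ longTimeAvgSup (fun t => Real.sqrt (Torus.eGradNormSq (v t)).toReal) :=
    longTimeAvgSup_nonneg fun t => Real.sqrt_nonneg _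
  have hL0 : 0 ≤ longTimeAvgSup (fun t => (Torus.eGradNormSq (v t)).toReal) :=
    longTimeAvgSup_nonneg fun t => ENNReal.toReal_nonneg
  calc (longTimeAvgSup (fun t => Real.sqrt (Torus.eGradNormSq (v t)).toReal)) ^ 2
      ≤ (Real.sqrt (longTimeAvgSup (fun t => (Torus.eGradNormSq (v t)).toReal))) ^ 2 :=
        pow_le_pow_left₀ hS0 (longTimeAvgSup_sqrt_eGradNormSq_le_sqrt hν hg hgz hLH) 2
    _ = longTimeAvgSup (fun t => (Torus.eGradNormSq (v t)).toReal) := Real.sq_sqrt hL0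

end Summit.AnomalousDissipation.AnomalousDissipation.Theorems.TwohalfdThesis

end
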